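import Summits.SmoothPoincare4.SmoothPoincare4.Theorems.CylinderEntropySliceIsolationOfCMS
import Literature.Geometry.Riemannian.LowEntropyHypersurfacesFourAssembly
import HarnessLib

/-!
# `CylinderEntropy.SliceIsolation` from Cor. 1.5 (b) of Chodosh–Mantoulidis–Schulze ALONE (line `conformal-kernel-domination`, chain β)

Sharpening of `Theorems/CylinderEntropySliceIsolationOfCMS.lean` (lead c2, p131364): there the crux
`Summit.SmoothPoincare4.SmoothPoincare4.Theses.CylinderEntropy.SliceIsolation` (stmt-SmoothPoincare4-7632) was derived from the
named fact `ChodoshMantoulidisSchulze2025_lowEntropy_sphere_four`, which is the CONJUNCTION of the diffeomorphism consequences of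
Cor. 1.5 (a) (`λ ≤ λ(𝕊³ × ℝ)`, smooth mean curvature flow to a round point) and Cor. 1.5 (b) (`λ ≤ λ(𝕊² × ℝ²) = 4/e`, flow with
surgery, simply connected case) of Chodosh–Mantoulidis–Schulze, Duke Math. J. 174 (2025), for `n = 4`.  The chain β proof only
ever applies clause (b) (`….of_le_shrinkingCylinder_two`), and the tree names that clause on its own:
`Literature.Geometry.Riemannian.ChodoshMantoulidisSchulze2025_cor15b_four` (`LowEntropyHypersurfacesFourAssembly.lean`, the second
conjunct verbatim).  This file re-runs the last two steps of the reduction against that weaker hypothesis, so that the crux is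
kernel-checked CLOSED MODULO EXACTLY ONE printed statement — Cor. 1.5 (b) / Cor. 1.22 (b), `n = 4`, simply connected case — and
no longer carries clause (a) as an idle hypothesis.  Everything else (the kernel certificates at all scales, among them the
computational mid-scale certificates `certMid_all` checked by `native_decide`, the measure bookkeeping `stub_dominationBookkeeping`,
the conformal embedding `stub_conformalEmbedding`, the instances from `M ≃ₕ S⁴`) is already in the tree; `ε = 4/(1.47 e) - 1`.
The theorem is CONDITIONAL on `ChodoshMantoulidisSchulze2025_cor15b_four` and on nothing else, and COMPUTATIONAL (its axiom
closure contains the `native_decide` certificates of `certMid_all`, exactly as p131364).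
-/

noncomputable section

-- the registered namespace `Summit.SmoothPoincare4.SmoothPoincare4.Theorems…` repeats a component
set_option linter.dupNamespace false

open MeasureTheory Set
open scoped Manifold ContDiff ENNReal Topology BigOperators

namespace Summit.SmoothPoincare4.SmoothPoincare4.Theorems.CylinderEntropySliceIsolation

open Literature.Geometry.Riemannian
open Literature.Geometry.Riemannian.SphericalCylinderEntropy (cylEntropy zonal)

/-- **Chain β reduction against Cor. 1.5 (b) alone.** `SliceIsolation` from `ChodoshMantoulidisSchulze2025_cor15b_four` and the
mid-scale kernel certificates on `[10⁻², 10]` (the registered stub `stub_certMid`, stated verbatim; proved in the tree as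
`certMid_all`).  Same proof as `sliceIsolation_of_certificates`, whose CMS hypothesis entered only through clause (b). [folklore] -/
theorem sliceIsolation_of_cor15b_of_certificates
    (hb : ChodoshMantoulidisSchulze2025_cor15b_four)
    (hmid : ∀ T : ℝ, 1 / 100 ≤ T → T ≤ 10 →
      ∃ (n : ℕ) (σ τ w : Fin n → ℝ) (c : ℝ), (∀ j, 0 < τ j) ∧ (∀ j, 0 ≤ w j) ∧ 0 ≤ c ∧ (∑ j, w j) + c ≤ 147 / 100 ∧
        ∀ u s : ℝ, -1 ≤ s → s ≤ 1 →
          (8 * Real.pi ^ 2 / 3) * ((4 * Real.pi * T) ^ 2)⁻¹ * Real.exp (4 * u) *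
              Real.exp (-(Real.exp (2 * u) - 2 * Real.exp u * s + 1) / (4 * T)) ≤
            (∑ j, w j * (zonal (τ j) s * Real.exp (-(u - σ j) ^ 2 / (4 * τ j)))) + c) :
    Summit.SmoothPoincare4.SmoothPoincare4.Theses.CylinderEntropy.SliceIsolation := by
  have he0 : 0 < Real.exp 1 := Real.exp_pos 1
  have he2 : Real.exp 1 < 2.7182818286 := Real.exp_one_lt_d9
  -- all-scales domination with constant `147/100`
  have hdom := stub_dominationBookkeeping (147 / 100) reductionCertificates_sphereEntropy_le
    (reductionCertificates_certAll hmid)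
  -- the explicit `ε`
  set ε : ℝ := 4 / (147 / 100 * Real.exp 1) - 1 with hε
  have hεpos : 0 < ε := by
    rw [hε, sub_pos, lt_div_iff₀ (by positivity)]
    nlinarith
  have hCε : (147 / 100 : ℝ) * (1 + ε) = 4 / Real.exp 1 := by
    rw [hε]; field_simp; ring
  refine ⟨ε, hεpos, ?_⟩
  intro M _ _ _ _ _ e ι hι hN hsep hent
  -- instances from `M ≃ₕ S⁴` (PROVED in the tree)
  haveI : CompactSpace M :=
    Literature.Topology.FourManifolds.compactSpace_of_homotopyEquiv_sphere_four_holds M e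
  haveI : PathConnectedSpace M := by
    haveI := Literature.Topology.FourManifolds.pathConnectedSpace_sphere_four
    exact Literature.Topology.FourManifolds.pathConnectedSpace_of_homotopyEquiv e
  have hsc : SimplyConnectedSpace M :=
    Literature.Topology.FourManifolds.simplyConnectedSpace_of_homotopyEquiv_sphere_four
      Literature.Topology.FourManifolds.simplyConnectedSpace_sphere_four_holds M e
  -- the cross-section `A = range ι ⊆ N`: measurable, of bounded height
  have hAN : Set.range ι ⊆ {z : EuclideanSpace ℝ (Fin 6) | ∑ i : Fin 5, z (Fin.castSucc i) ^ 2 = 1} := by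
    rintro _ ⟨x, rfl⟩
    exact hN x
  have hcpt : IsCompact (Set.range ι) := isCompact_range hι.isEmbedding.continuous
  have hAm : MeasurableSet (Set.range ι) := hcpt.isClosed.measurableSet
  have hAb : ∃ B : ℝ, ∀ z ∈ Set.range ι, |z 5| ≤ B := by
    obtain ⟨B, hB⟩ := hcpt.exists_bound_of_continuousOn
      ((EuclideanSpace.proj (5 : Fin 6)).continuous.continuousOn)
    exact ⟨B, fun z hz => by simpa [Real.norm_eq_abs] using hB z hz⟩
  have hent' : cylEntropy (Set.range ι) < ENNReal.ofReal (1 + ε) := hent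
  -- the Euclidean entropy of `Φ(range ι)` is at most `4/e = λ(S² × ℝ²)`
  have hbound : gaussianEntropy 4 ((fun z : EuclideanSpace ℝ (Fin 6) =>
      (WithLp.toLp 2 (fun i : Fin 5 => Real.exp (z 5) * z (Fin.castSucc i)) : EuclideanSpace ℝ (Fin 5))) '' Set.range ι) ≤
      gaussianEntropy 4 (shrinkingCylinder 4 2) := by
    calc gaussianEntropy 4 ((fun z : EuclideanSpace ℝ (Fin 6) =>
      (WithLp.toLp 2 (fun i : Fin 5 => Real.exp (z 5) * z (Fin.castSucc i)) : EuclideanSpace ℝ (Fin 5))) '' Set.range ι)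
        ≤ ENNReal.ofReal (147 / 100) * cylEntropy (Set.range ι) := hdom _ hAN hAm hAb
      _ ≤ ENNReal.ofReal (147 / 100) * ENNReal.ofReal (1 + ε) := by gcongr
      _ = ENNReal.ofReal (4 / Real.exp 1) := by
          rw [← ENNReal.ofReal_mul (by norm_num), hCε]
      _ = gaussianEntropy 4 (shrinkingCylinder 4 2) := gaussianEntropy_shrinkingCylinder_four_two.symm
  -- recognition: `Φ ∘ ι` is a smooth embedding (PROVED stub) and Cor. 1.5 (b) for the simply connected `M`
  have hemb : Manifold.IsSmoothEmbedding (𝓡 4) (𝓡 5) ∞ ((fun z : EuclideanSpace ℝ (Fin 6) =>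
      (WithLp.toLp 2 (fun i : Fin 5 => Real.exp (z 5) * z (Fin.castSucc i)) : EuclideanSpace ℝ (Fin 5))) ∘ ι) :=
    stub_conformalEmbedding M ι hι hN
  refine hb M hsc _ hemb ?_
  rwa [Set.range_comp]

/-- **`SliceIsolation` from Cor. 1.5 (b) alone** (registered helper `helper_sliceIsolationOfCor15b` of crux stmt-SmoothPoincare4-7632):
the crux is closed modulo the single printed statement `ChodoshMantoulidisSchulze2025_cor15b_four` (Chodosh–Mantoulidis–Schulze 2025,
Cor. 1.5 (b) = Cor. 1.22 (b), `n = 4`, simply connected case), with `ε = 4/(1.47 e) - 1`; the mid-scale certificates are the tree's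
computational `certMid_all`. [folklore] -/
theorem helper_sliceIsolationOfCor15b :
    Literature.Geometry.Riemannian.ChodoshMantoulidisSchulze2025_cor15b_four →
      Summit.SmoothPoincare4.SmoothPoincare4.Theses.CylinderEntropy.SliceIsolation :=
  fun hb => sliceIsolation_of_cor15b_of_certificates hb certMid_all

/-- The old conditional from the conjunction is the special case `hCMS.2` (consistency check with p131364). [folklore] -/
theorem helper_sliceIsolationOfCMS' (hCMS : ChodoshMantoulidisSchulze2025_lowEntropy_sphere_four) :
    Summit.SmoothPoincare4.SmoothPoincare4.Theses.CylinderEntropy.SliceIsolation :=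
  helper_sliceIsolationOfCor15b hCMS.2

end Summit.SmoothPoincare4.SmoothPoincare4.Theorems.CylinderEntropySliceIsolation

end
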